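import Summits.ResolutionOfSingularities.ResolutionOfSingularities.Theorems.WildConesCampaignW46ThreefoldsCharTwoNearPoint

/-!
# [OURS · L1 W4.6, rung (ii) at p = 2] EXISTENCE of the infinitely-near double point: an order-2-cleaned
# isolated threefold double point in characteristic two has a double point among its point-blow-up successors
# IFF `μ ≥ 4` — equivalently it is resolved by ONE blow-up iff `μ = 2` — over EVERY field of characteristic 2

Cell res-hironaka (LADDER-RESOLUTION rung L, D-0089), slot W4.6, seat res-L1-s46-pv-4 (gen 2); host route
`WildCones`, crux `ClassicalRegimes` (stmt-ResolutionOfSingularities-16884). Sequel to `…CharTwoNearPoint`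
(uniqueness of the near double point, p479531) of the same seat.

HONEST FRAMING. Everything here is OURS: theorems about route WildCones' own typed point-blow-up dynamics
(`Theorems/WildConesClassicalRegimesDefs.lean`). Together with `…CharTwoNearPoint` it REPLACES THE ROLE of
the determinacy of the next centre of the iterated procedure (Th. 16.6 p.84 L4–L6, `D′ = ∇′ ∩ π⁻¹(D)`;
§16.3 p.87 L14–L16) in ONE regime — order-2-cleaned isolated double points `z² = a(u₀,u₁,u₂)` in
characteristic `2`: the next singular point EXISTS iff `μ ≥ 4`, and then it is unique (p479531) and again
in the regime with `μ − 2` (p479260). NOTHING here is a statement of the manuscript [Hironaka2017]; no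
FACT-LIST premise. AI review is weaker than expert review.

THE ARGUMENT. Let `{j, l}` be a hyperbolic pair of the cleaned quadratic form `q` (`q_{jl} ≠ 0`) and `i`
the third index; PIN the translation `τ*` by `τ*_j = q_{il}/q_{jl}`, `τ*_l = q_{ij}/q_{jl}` (the radical of
the polar form, cf. `threefold_nearPoint_formula`). Then the strict transform `T*` has `[u_j]T* = [u_l]T* = 0`
(`coeff_single_serT_eq_zero_of_pinned`), so it is a double point unless `[u_i]T* ≠ 0`. In that case
`∂_i T*` is a unit, the Milnor algebra of `T*` is ZERO, and the tree's descent — run with the OFF-CHART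
linear hypotheses only (`descent_step_offChart`, adapted from `WildCones.MuDropCharTwoOrdP.descent_step`,
whose blanket hypothesis «no linear terms» is used only at `j, l`) — transports the pair `(a, T*)` to one
variable, `a' = X² G'` with `κ⟦X⟧/(G'') = 0`, whence `μ(a) = 0 + 2 = 2` (`JacobianBudget.CharTwo.curve_drop_eq`).
Contrapositive: `μ ≥ 4` ⇒ the successor at `(i, τ*)` IS a double point.

* `descent_step_offChart` — the adapted descent step (every `n`).
* `coeff_single_serT_eq_zero_of_pinned` — the pinned translation kills the off-chart linear coefficients.
* `threefold_mu_eq_two_of_chart_linear` — pinned translation and `[u_i]T ≠ 0` force `μ = 2`.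
* `threefold_exists_double_successor_of_four_le_mu`, `threefold_exists_double_successor_iff_four_le_mu`,
  `threefold_resolved_in_one_iff_mu_eq_two` — the existence statements.

References: G.-M. Greuel, G. Pfister, J. Algebra 689 (2026) = arXiv:2507.17078, Thm 3.5 / Cor 3.7
[GreuelPfister2026] (through the tree's `pair_reduction`/`descent`); H. Hironaka, ms. 2017, Th. 16.6
p.84, §16.3 p.87 — quoted for the ROLE replaced only, under adjudication, not cited as fact.
-/

noncomputable section

-- single-problem summit: the doubled namespace component `ResolutionOfSingularities` is forced
set_option linter.dupNamespace false

open scoped BigOperators Classical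

open MvPowerSeries IsLocalRing

open Literature.AlgebraicGeometry.Resolution

namespace Summit.ResolutionOfSingularities.ResolutionOfSingularities.Theorems

namespace CampaignW46.ThreefoldsCharTwo

open WildCones WildCones.MuDropCharTwoOrdP

variable {κ : Type} [Field κ]

/-! ## The descent step with off-chart linear hypotheses only (adapted from the tree) -/

-- adapted from Theorems/WildConesClassicalRegimesStubMuDropCharTwoOrdPDescent.lean (`descent_step`)

/-- [OURS · L1 W4.6] **THE DESCENT STEP WITH OFF-CHART LINEAR HYPOTHESES ONLY** (characteristic two;
adapted from the tree's `WildCones.MuDropCharTwoOrdP.descent_step`, whose hypothesis «`G` has NO linear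
terms» is weakened to «`[X_j] G = [X_l] G = 0` for the hyperbolic pair `j, l` avoiding the chart index» —
the `X_i`-linear coefficient of the strict transform is left free, and accordingly nothing is claimed
about the linear terms of `G'`; the proof is otherwise verbatim). Let `X_i² G = a∘Φ_{i,τ}` with
`ord a ≥ 2` and `[X_j X_l] a ≠ 0` for a pair `j ≠ l` avoiding `i`. Then, killing `X_j, X_l` after the
two reductions, one obtains `a', G'` in `n - 2` variables in the same relation, with isomorphic Milnor
algebras. [cite: GreuelPfister2026, Thm 3.5 and Cor 3.7] -/
theorem descent_step_offChart [CharP κ 2] {n m : ℕ} (i : Fin n) (τ : Fin n → κ)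
    {a G : MvPowerSeries (Fin n) κ} (ha : 2 ≤ a.order)
    (hG : X i ^ 2 * G = subst (fun s => if s = i then (X i : MvPowerSeries (Fin n) κ)
      else X i * (X s + C (τ s))) a)
    {j l : Fin n} (hjl : j ≠ l) (hj : j ≠ i) (hl : l ≠ i)
    (hq : coeff (Finsupp.single j 1 + Finsupp.single l 1) a ≠ 0)
    (hGj : coeff (Finsupp.single j 1) G = 0) (hGl : coeff (Finsupp.single l 1) G = 0)
    (e : Fin m ↪ Fin n) (he : ∀ s, s ∈ Set.range e ↔ s ≠ j ∧ s ≠ l) (i' : Fin m) (hi' : e i' = i) :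
    ∃ a' G' : MvPowerSeries (Fin m) κ, 2 ≤ a'.order ∧
      X i' ^ 2 * G' = subst (fun t => if t = i' then (X i' : MvPowerSeries (Fin m) κ)
        else X i' * (X t + C (τ (e t)))) a' ∧
      Nonempty ((MvPowerSeries (Fin n) κ ⧸ Ideal.span (Set.range fun s => MvPowerSeries.pderiv s a))
        ≃ₐ[κ] (MvPowerSeries (Fin m) κ ⧸ Ideal.span (Set.range fun t => MvPowerSeries.pderiv t a'))) ∧
      Nonempty ((MvPowerSeries (Fin n) κ ⧸ Ideal.span (Set.range fun s => MvPowerSeries.pderiv s G))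
        ≃ₐ[κ] (MvPowerSeries (Fin m) κ ⧸ Ideal.span (Set.range fun t => MvPowerSeries.pderiv t G'))) := by
  have ha' := (FormalCoordChange.two_le_order_iff a).mp ha
  have hqG : coeff (Finsupp.single j 1 + Finsupp.single l 1) G =
      coeff (Finsupp.single j 1 + Finsupp.single l 1) a := coeff_pair_strict i τ ha hG hjl hj hl
  obtain ⟨F, hθ0, hF, hJ, hdj, hdl, hXj, hXl⟩ := pair_reduction hjl hq (ha'.2 j) (ha'.2 l)
  obtain ⟨F', hθ'0, hF', hJ', hdj', hdl', hXj', hXl'⟩ :=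
    pair_reduction (f := G) hjl (by rw [hqG]; exact hq) hGj hGl
  rw [hqG] at hθ'0 hF'
  set q := coeff (Finsupp.single j 1 + Finsupp.single l 1) a with hq'
  set θ : Fin n → MvPowerSeries (Fin n) κ := fun s => if s = j then q⁻¹ • MvPowerSeries.pderiv l a
      else if s = l then q⁻¹ • MvPowerSeries.pderiv j a else X s with hθ
  set θ' : Fin n → MvPowerSeries (Fin n) κ := fun s => if s = j then q⁻¹ • MvPowerSeries.pderiv l G
      else if s = l then q⁻¹ • MvPowerSeries.pderiv j G else X s with hθ'
  have hθsub : HasSubst θ := hasSubst_of_constantCoeff_zero hθ0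
  have hθ'sub : HasSubst θ' := hasSubst_of_constantCoeff_zero hθ'0
  have hΦ := hasSubst_blowFam i τ
  -- the translation vector with the `j`, `l` components zeroed
  set τ' : Fin n → κ := Function.update (Function.update τ j 0) l 0 with hτ'
  have hτ'j : τ' j = 0 := by
    rw [hτ', Function.update_of_ne hjl, Function.update_self]
  have hτ'l : τ' l = 0 := by rw [hτ', Function.update_self]
  have hτ's : ∀ s, s ≠ j → s ≠ l → τ' s = τ s := fun s hsj hsl => by
    rw [hτ', Function.update_of_ne hsl, Function.update_of_ne hsj]
  have hΦ' := hasSubst_blowFam i τ'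
  have hθi : θ i = X i := by simp [hθ, Ne.symm hj, Ne.symm hl]
  have hθ'i : θ' i = X i := by simp [hθ', Ne.symm hj, Ne.symm hl]
  -- STEP A: the two composite substitution families agree
  have hfam : ∀ s, subst (fun s => if s = i then (X i : MvPowerSeries (Fin n) κ)
      else X i * (X s + C (τ s))) (θ s) =
      subst θ' ((fun s => if s = i then (X i : MvPowerSeries (Fin n) κ) else X i * (X s + C (τ' s))) s) := by
    intro s
    by_cases hsj : s = j
    · rw [hsj]
      simp only [hθ, hθ', if_true, if_neg hj, hτ'j, map_zero, add_zero]
      rw [subst_smul hΦ, ← X_mul_pderiv_strict_of_ne i τ hl hG, subst_mul hθ'sub, subst_X hθ'sub,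
        subst_X hθ'sub, hθ'i]
      simp only [hθ', if_true, mul_smul_comm]
    · by_cases hsl : s = l
      · rw [hsl]
        simp only [hθ, hθ', if_neg (Ne.symm hjl), if_true, if_neg hl, hτ'l, map_zero, add_zero]
        rw [subst_smul hΦ, ← X_mul_pderiv_strict_of_ne i τ hj hG, subst_mul hθ'sub, subst_X hθ'sub,
          subst_X hθ'sub, hθ'i]
        simp only [hθ', if_neg (Ne.symm hjl), if_true, mul_smul_comm]
      · have hθs : θ s = X s := by simp [hθ, hsj, hsl]
        have hθ's : θ' s = X s := by simp [hθ', hsj, hsl]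
        rw [hθs, subst_X hΦ]
        by_cases hsi : s = i
        · rw [hsi]; simp only [if_true]; rw [subst_X hθ'sub, hθ'i]
        · simp only [if_neg hsi, hτ's s hsj hsl]
          rw [subst_mul hθ'sub, subst_add hθ'sub, subst_X hθ'sub, subst_X hθ'sub, subst_C,
            hθ'i, hθ's]
  have hcomm : ∀ g, subst (fun s => if s = i then (X i : MvPowerSeries (Fin n) κ)
      else X i * (X s + C (τ s))) (F g) =
      F' (subst (fun s => if s = i then (X i : MvPowerSeries (Fin n) κ) else X i * (X s + C (τ' s))) g) := by
    intro g
    rw [hF, hF', subst_comp_subst_apply hθsub hΦ, subst_comp_subst_apply hΦ' hθ'sub]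
    congr 1
    funext s
    exact hfam s
  -- STEP B: the reduced pair is again a strict-transform pair
  set a1 := F.symm a with ha1
  set G1 := F'.symm G with hG1
  have hFX' : F' (X i) = X i := by rw [hF', subst_X hθ'sub, hθ'i]
  have hB : X i ^ 2 * G1 = subst (fun s => if s = i then (X i : MvPowerSeries (Fin n) κ)
      else X i * (X s + C (τ' s))) a1 := by
    apply F'.injective
    have : a = F a1 := (F.apply_symm_apply a).symm
    rw [map_mul, map_pow, hFX', hG1, F'.apply_symm_apply, hG, this, hcomm]
  -- STEP C: kill `X_j`, `X_l`
  refine ⟨killCompl e a1, killCompl e G1, two_le_order_killCompl e (le_order_algEquiv F.symm ha),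
    ?_, descent e he F hJ hdj hdl hXj hXl, descent e he F' hJ' hdj' hdl' hXj' hXl'⟩
  · have hC := congrArg (killCompl e) hB
    rw [map_mul, map_pow, ← hi', killCompl_X, killCompl_subst e (constantCoeff_blowFam (e i') τ')] at hC
    rw [hC, ← subst_extend_eq_subst_killCompl e he _ (constantCoeff_blowFam i' (fun t => τ (e t)))]
    congr 1
    funext s
    by_cases hs : ∃ t, e t = s
    · obtain ⟨t, rfl⟩ := hs
      rw [e.injective.extend_apply]
      have hne : e t ≠ j ∧ e t ≠ l := (he (e t)).mp ⟨t, rfl⟩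
      by_cases hti : t = i'
      · rw [if_pos (congrArg e hti), if_pos hti, killCompl_X]
      · rw [if_neg (fun h => hti (e.injective h)), if_neg hti, map_mul, map_add, killCompl_X,
          killCompl_X, killCompl_C, hτ's _ hne.1 hne.2]
    · rw [Function.extend_apply' _ _ _ hs, Pi.zero_apply]
      have hs' : s = j ∨ s = l := by
        have := (he s).not.mp hs
        tauto
      have hsi : s ≠ e i' := fun h => hs ⟨i', h.symm⟩
      simp only [if_neg hsi, map_mul, map_add, killCompl_C]
      rw [killCompl_X_eq_zero (fun h => hs h), zero_add]
      rcases hs' with rfl | rfl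
      · rw [hτ'j, map_zero, mul_zero]
      · rw [hτ'l, map_zero, mul_zero]

/-! ## The pinned translation -/

/-- [OURS · L1 W4.6 rung (ii) at `p = 2`; NOT a statement of the manuscript] **The PINNED translation
kills the off-chart linear coefficients of the strict transform** (threefold double points, any field of
characteristic `2`): for a double state `c` with cleaned quadratic form `q`, chart `i` and the two other
indices `j ≠ l`, if `τ_j q_{jl} = q_{il}` and `τ_l q_{jl} = q_{ij}` then `[u_j] T = [u_l] T = 0` for the
strict transform `T` (before its final cleaning). Converse of `threefold_nearPoint_formula`. [folklore] -/
theorem coeff_single_serT_eq_zero_of_pinned [CharP κ 2] (c : (Fin 3 → ℕ) → κ) (i : Fin 3)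
    (τ : Fin 3 → κ) (hM : MultP 2 3 κ c) {j l : Fin 3} (hjl : j ≠ l) (hj : j ≠ i) (hl : l ≠ i)
    (hτj : τ j * coeff (Finsupp.single j 1 + Finsupp.single l 1) (ser 2 3 κ c) =
      coeff (Finsupp.single i 1 + Finsupp.single l 1) (ser 2 3 κ c))
    (hτl : τ l * coeff (Finsupp.single j 1 + Finsupp.single l 1) (ser 2 3 κ c) =
      coeff (Finsupp.single i 1 + Finsupp.single j 1) (ser 2 3 κ c)) {m : Fin 3} (hm : m ≠ i) :
    coeff (Finsupp.single m 1) (show MvPowerSeries (Fin 3) κ from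
      fun A : Fin 3 →₀ ℕ => tr 3 κ i τ 2 (dv 3 κ i 2 (bl 3 κ i (clean 2 3 κ c))) ⇑A) = 0 := by
  rw [coeff_single_strict i τ (two_le_order_ser hM) (X_pow_mul_serT_eq_subst c i τ hM) hm]
  -- `m` is `j` or `l`; the other off-chart index is `l` resp. `j`
  have key : ∀ {m o : Fin 3}, m ≠ i → o ≠ i → m ≠ o →
      τ o * coeff (Finsupp.single o 1 + Finsupp.single m 1) (ser 2 3 κ c) =
        coeff (Finsupp.single i 1 + Finsupp.single m 1) (ser 2 3 κ c) →
      coeff (Finsupp.single i 1 + Finsupp.single m 1) (ser 2 3 κ c) +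
        ∑ s ∈ Finset.univ.erase i, τ s * ((((Finsupp.single s 1 : Fin 3 →₀ ℕ) m : ℕ) : κ) + 1) *
          coeff (Finsupp.single s 1 + Finsupp.single m 1) (ser 2 3 κ c) = 0 := by
    intro m o hm ho hmo hpin
    rw [Finset.sum_eq_single_of_mem o (Finset.mem_erase.mpr ⟨ho, Finset.mem_univ o⟩)]
    · have h1 : (((Finsupp.single o 1 : Fin 3 →₀ ℕ) m : ℕ) : κ) + 1 = 1 := by
        simp [Ne.symm hmo]
      rw [h1, mul_one, hpin]
      exact CharTwo.add_self_eq_zero _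
    · intro s hs hso
      have hsi : s ≠ i := Finset.ne_of_mem_erase hs
      rcases fin_three_eq_or (Ne.symm hm) (Ne.symm ho) hmo s with rfl | rfl | rfl
      · exact absurd rfl hsi
      · have h0 : (((Finsupp.single s 1 : Fin 3 →₀ ℕ) s : ℕ) : κ) + 1 = 0 := by
          simp only [Finsupp.single_eq_same, Nat.cast_one]
          exact CharTwo.add_self_eq_zero 1
        rw [h0, mul_zero, zero_mul]
      · exact absurd rfl hso
  rcases fin_three_eq_or (Ne.symm hj) (Ne.symm hl) hjl m with rfl | rfl | rfl
  · exact absurd rfl hm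
  · refine key hj hl hjl ?_
    rw [add_comm (Finsupp.single l 1)]
    exact hτl
  · exact key hl hj (Ne.symm hjl) hτj

/-! ## `[u_i] T ≠ 0` at the pinned translation forces `μ = 2` -/

/-- [OURS · L1 W4.6 rung (ii) at `p = 2`; NOT a statement of the manuscript] **A non-zero chart-linear
coefficient at the pinned translation forces `μ = 2`.** Threefold double points over any field of
characteristic `2`: let `c` be a double state with a hyperbolic pair `{j, l}` (`q_{jl} ≠ 0`) avoiding the
chart index `i`, and `τ` a translation at which the strict transform `T` has `[u_j]T = [u_l]T = 0` but
`[u_i]T ≠ 0`. Then `μ(c) = 2` (in particular `c` is isolated — not assumed): `∂_i T` is a unit, so the Milnor algebra of `T`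
vanishes; `descent_step_offChart` carries `(a, T)` to one variable, `a' = X² G'` with `κ⟦X⟧/(G'') = 0`,
and `curve_drop_eq` gives `μ = 0 + 2`. [cite: GreuelPfister2026, Thm 3.5 and Cor 3.7] -/
theorem threefold_mu_eq_two_of_chart_linear [CharP κ 2] (c : (Fin 3 → ℕ) → κ) (i : Fin 3)
    (τ : Fin 3 → κ) (hM : MultP 2 3 κ c) {j l : Fin 3} (hjl : j ≠ l) (hj : j ≠ i)
    (hl : l ≠ i) (hq : coeff (Finsupp.single j 1 + Finsupp.single l 1) (ser 2 3 κ c) ≠ 0)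
    (hTj : coeff (Finsupp.single j 1) (show MvPowerSeries (Fin 3) κ from
      fun A : Fin 3 →₀ ℕ => tr 3 κ i τ 2 (dv 3 κ i 2 (bl 3 κ i (clean 2 3 κ c))) ⇑A) = 0)
    (hTl : coeff (Finsupp.single l 1) (show MvPowerSeries (Fin 3) κ from
      fun A : Fin 3 →₀ ℕ => tr 3 κ i τ 2 (dv 3 κ i 2 (bl 3 κ i (clean 2 3 κ c))) ⇑A) = 0)
    (hTi : coeff (Finsupp.single i 1) (show MvPowerSeries (Fin 3) κ from
      fun A : Fin 3 →₀ ℕ => tr 3 κ i τ 2 (dv 3 κ i 2 (bl 3 κ i (clean 2 3 κ c))) ⇑A) ≠ 0) :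
    mu 2 3 κ c = 2 := by
  set T : MvPowerSeries (Fin 3) κ := (show MvPowerSeries (Fin 3) κ from
      fun A : Fin 3 →₀ ℕ => tr 3 κ i τ 2 (dv 3 κ i 2 (bl 3 κ i (clean 2 3 κ c))) ⇑A) with hT
  have ha := two_le_order_ser hM
  have hG := X_pow_mul_serT_eq_subst c i τ hM
  -- the Milnor algebra of `T` is zero: `∂_i T` is a unit
  have hunit : IsUnit (MvPowerSeries.pderiv i T) := by
    rw [isUnit_iff_constantCoeff, constantCoeff_pderiv]
    exact isUnit_iff_ne_zero.mpr hTi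
  have htop : Ideal.span (Set.range fun s => MvPowerSeries.pderiv s T) = ⊤ :=
    Ideal.eq_top_of_isUnit_mem _ (Ideal.subset_span ⟨i, rfl⟩) hunit
  -- descend to one variable
  obtain ⟨e, i', he, hi', -⟩ := exists_compl_embedding hjl (Ne.symm hj) (Ne.symm hl)
  obtain ⟨a', G', -, hG', ⟨εa⟩, ⟨εG⟩⟩ :=
    descent_step_offChart i τ ha hG hjl hj hl hq hTj hTl e he i' hi'
  -- the Milnor algebra of `G'` is zero, in particular finite of rank `0`
  haveI hsub : Subsingleton (MvPowerSeries (Fin 3) κ ⧸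
      Ideal.span (Set.range fun s => MvPowerSeries.pderiv s T)) := by
    rw [htop]
    exact Ideal.Quotient.subsingleton_iff.mpr rfl
  haveI hsub' : Subsingleton (MvPowerSeries (Fin (3 - 2)) κ ⧸
      Ideal.span (Set.range fun t => MvPowerSeries.pderiv t G')) := εG.symm.toEquiv.subsingleton
  have hfG' : Module.Finite κ (MvPowerSeries (Fin (3 - 2)) κ ⧸
      Ideal.span (Set.range fun t => MvPowerSeries.pderiv t G')) := Module.Finite.of_finite
  have h0 : Module.finrank κ (MvPowerSeries (Fin (3 - 2)) κ ⧸
      Ideal.span (Set.range fun t => MvPowerSeries.pderiv t G')) = 0 := Module.finrank_zero_of_subsingleton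
  have hcurve := JacobianBudget.CharTwo.curve_drop_eq i' (fun t => τ (e t)) hG' hfG'
  rw [h0, zero_add] at hcurve
  rw [mu_eq_finrank_pderiv, εa.toLinearEquiv.finrank_eq, ← hcurve]

/-! ## Existence of the infinitely-near double point iff `μ ≥ 4` -/

/-- An exponent of degree `1` is a unit vector `e_m`. [folklore] -/
theorem exists_eq_single_of_sum_eq_one {n : ℕ} {A : Fin n → ℕ}
    (h : Finset.sum Finset.univ (fun j => A j) = 1) : ∃ m : Fin n, A = ⇑(Finsupp.single m 1 : Fin n →₀ ℕ) := by
  have hex : ∃ m, A m ≠ 0 := by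
    by_contra h0
    push Not at h0
    rw [Finset.sum_eq_zero (fun j _ => h0 j)] at h
    exact zero_ne_one h
  obtain ⟨m, hm⟩ := hex
  have hle : ∀ s, A s ≤ 1 := fun s =>
    h ▸ Finset.single_le_sum (f := A) (fun _ _ => Nat.zero_le _) (Finset.mem_univ s)
  refine ⟨m, funext fun s => ?_⟩
  by_cases hs : s = m
  · subst hs
    have := hle s
    rw [Finsupp.single_eq_same]
    omega
  · have h2 : A m + A s ≤ Finset.sum Finset.univ (fun j => A j) :=
      Finset.add_le_sum (fun _ _ => Nat.zero_le _) (Finset.mem_univ m) (Finset.mem_univ s) (Ne.symm hs)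
    rw [Finsupp.single_apply, if_neg (Ne.symm hs)]
    omega

/-- Two distinct indices of `Fin 3` leave a third one. [folklore] -/
theorem fin_three_exists_third : ∀ j l : Fin 3, j ≠ l → ∃ i : Fin 3, i ≠ j ∧ i ≠ l := by decide

/-- [OURS · L1 W4.6 rung (ii) at `p = 2`; NOT a statement of the manuscript] **`μ ≥ 4` ⇒ an
infinitely-near DOUBLE point exists.** Over any field of characteristic `2`, an order-2-cleaned isolated
double point of `z² = a(u₀,u₁,u₂)` with Milnor number `≥ 4` (isolatedness is then automatic and not
assumed) has a double point among its point-blow-up successors — in the chart of the index off a hyperbolic pair, at the PINNED translation (the radical of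
the polar form); by `threefold_regime_step` it is again an order-2-cleaned isolated double point, with
`μ − 2`, and by `threefold_nearPoint_unique` it is the only one in its chart. [cite: GreuelPfister2026, Thm 3.5 and Cor 3.7] -/
theorem threefold_exists_double_successor_of_four_le_mu [CharP κ 2] (c : (Fin 3 → ℕ) → κ)
    (hM : MultP 2 3 κ c) (hO : OrdP 2 3 κ c) (hμ : 4 ≤ mu 2 3 κ c) :
    ∃ (i : Fin 3) (τ : Fin 3 → κ), MultP 2 3 κ (step 2 3 κ i τ c) := by
  obtain ⟨j, l, hjl, hq⟩ := (ordP_two_iff_exists_pair c).mp hO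
  obtain ⟨i, hij, hil⟩ := fin_three_exists_third j l hjl
  set q := coeff (Finsupp.single j 1 + Finsupp.single l 1) (ser 2 3 κ c) with hqdef
  -- the pinned translation
  set τ : Fin 3 → κ := fun s => if s = j then q⁻¹ * coeff (Finsupp.single i 1 + Finsupp.single l 1)
      (ser 2 3 κ c) else if s = l then q⁻¹ * coeff (Finsupp.single i 1 + Finsupp.single j 1) (ser 2 3 κ c)
      else 0 with hτ
  have hτj : τ j * q = coeff (Finsupp.single i 1 + Finsupp.single l 1) (ser 2 3 κ c) := by
    simp only [hτ, if_true]
    rw [mul_comm, ← mul_assoc, mul_inv_cancel₀ hq, one_mul]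
  have hτl : τ l * q = coeff (Finsupp.single i 1 + Finsupp.single j 1) (ser 2 3 κ c) := by
    simp only [hτ, if_neg (Ne.symm hjl), if_true]
    rw [mul_comm, ← mul_assoc, mul_inv_cancel₀ hq, one_mul]
  refine ⟨i, τ, ?_⟩
  by_contra hM'
  -- the successor is non-zero and not a double point: it has a linear cleaned monomial `u_m`
  obtain ⟨A, hA, hdeg⟩ := exists_linear_of_not_multP (ser_step_ne_zero_of_ordP c i τ hM hO) hM'
  -- `A = e_m`
  obtain ⟨m, hm⟩ := exists_eq_single_of_sum_eq_one hdeg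
  -- its coefficient is the linear coefficient `[u_m] T`
  have hlin : coeff (Finsupp.single m 1) (show MvPowerSeries (Fin 3) κ from
      fun A : Fin 3 →₀ ℕ => tr 3 κ i τ 2 (dv 3 κ i 2 (bl 3 κ i (clean 2 3 κ c))) ⇑A) ≠ 0 := by
    have hm1 : ¬ 2 ∣ (⇑(Finsupp.single m 1 : Fin 3 →₀ ℕ)) m := by simp
    have h := hA
    rw [hm, OrdPExitSurface.step_eq i τ hM, CaseAExitOrdSucc.clean_clean,
      OrdPExitSurface.clean_apply_of_not_dvd _ _ m hm1] at h
    exact h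
  -- off the chart the linear coefficients vanish (pinned), so `m = i`
  have hpin := fun {m : Fin 3} (hm : m ≠ i) =>
    coeff_single_serT_eq_zero_of_pinned c i τ hM hjl (Ne.symm hij) (Ne.symm hil) hτj hτl hm
  have hmi : m = i := by
    by_contra hmi
    exact hlin (hpin hmi)
  subst hmi
  -- hence `μ = 2`, contradicting `μ ≥ 4`
  have h2 := threefold_mu_eq_two_of_chart_linear c m τ hM hjl (Ne.symm hij) (Ne.symm hil) hq
    (hpin (Ne.symm hij)) (hpin (Ne.symm hil)) hlin
  omega

/-- [OURS · L1 W4.6 rung (ii) at `p = 2`; NOT a statement of the manuscript] **An order-2-cleaned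
isolated threefold double point in characteristic two has an infinitely-near double point IFF `μ ≥ 4`**
(any field of characteristic `2`; `→` is `threefold_four_le_mu_of_double_successor`, p479531). [folklore] -/
theorem threefold_exists_double_successor_iff_four_le_mu [CharP κ 2] (c : (Fin 3 → ℕ) → κ)
    (hM : MultP 2 3 κ c) (hO : OrdP 2 3 κ c) (hI : Isol 2 3 κ c) :
    (∃ (i : Fin 3) (τ : Fin 3 → κ), MultP 2 3 κ (step 2 3 κ i τ c)) ↔ 4 ≤ mu 2 3 κ c :=
  ⟨fun ⟨i, τ, h⟩ => threefold_four_le_mu_of_double_successor c i τ hM hO hI h,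
    threefold_exists_double_successor_of_four_le_mu c hM hO⟩

/-- [OURS · L1 W4.6 rung (ii) at `p = 2`; NOT a statement of the manuscript] **Resolved by ONE blow-up
iff `μ = 2`**: an order-2-cleaned isolated threefold double point in characteristic two has no double
point among its point-blow-up successors (every successor is a smooth point, `exists_linear_of_not_multP`)
iff its Milnor number is `2` (any field of characteristic `2`; `μ` is even and `≥ 2`, p479260). [folklore] -/
theorem threefold_resolved_in_one_iff_mu_eq_two [CharP κ 2] (c : (Fin 3 → ℕ) → κ)
    (hM : MultP 2 3 κ c) (hO : OrdP 2 3 κ c) (hI : Isol 2 3 κ c) :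
    (∀ (i : Fin 3) (τ : Fin 3 → κ), ¬ MultP 2 3 κ (step 2 3 κ i τ c)) ↔ mu 2 3 κ c = 2 := by
  constructor
  · intro h
    have h2 := threefold_two_le_mu hM hO hI
    by_contra hne
    obtain ⟨k, hk⟩ := threefold_mu_even hM hO hI
    have h4 : 4 ≤ mu 2 3 κ c := by omega
    obtain ⟨i, τ, hM'⟩ := threefold_exists_double_successor_of_four_le_mu c hM hO h4
    exact h i τ hM'
  · intro h i τ
    exact threefold_no_double_successor_of_mu_eq_two c hM hO hI h i τ

end CampaignW46.ThreefoldsCharTwo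

end Summit.ResolutionOfSingularities.ResolutionOfSingularities.Theorems

end
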